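import Mathlib
import HarnessLib
import Summits.NavierStokesRegularity.NavierStokesRegularity.Theorems.UnthreadedDoorAntidynamoWallOneInstantLocalSymmetry

/-!
# Route `UnthreadedDoor` / `ThreadingFlux`, crux `PoloidalLiouville` (stmt-NavierStokesRegularity-1222), antidynamo v2 skeleton (sha16 `4ebf5683127b`),
# WALL `stub_scalarLiouville`: one-instant symmetry under a FIXED-POINT-FREE rigid motion (translation, screw, glide) ⇒ irrotational

Support file (seat leafhand-ns-unthreadeddoor-2 g2, cell decomp-ns), `--supports stmt-NavierStokesRegularity-1222 --as helper`; theorems only.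

Complement to `…WallOneInstantSymmetry` (rigid motions WITH a fixed point `x₁`).  If at ONE instant the vorticity of the wall's flow is symmetric as a
pseudovector under a rigid motion `g(y) = R y + b` — `curl v(t₁)(R y + b) = det R • R (curl v(t₁)(y))` — then `g(x₀)` is a SECOND CENTRE of tangency at
that instant; so EITHER `g(x₀) ≠ x₀` and the flow is irrotational (`curl_eq_zero_of_two_centres_slice`: `g(x₀) − x₀` is a flat direction, one-instant Z), OR
`g` fixes `x₀` and the one-instant rigid-symmetry dichotomy about `x₀` applies:

* ★★★ `curl_eq_zero_or_curl_symmetric_of_curl_rigidMotion_slice` — symmetric under `y ↦ R y + b` at ONE instant ⇒ `curl v ≡ 0`, OR (`R x₀ + b = x₀` AND the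
  vorticity is `R`-symmetric about `x₀` at EVERY instant); `…_or_equivariant_…` — … or the velocity is exactly `R`-equivariant about `x₀` at every time.
* ★★ `curl_eq_zero_of_curl_translate_slice` — vorticity invariant under ONE non-zero translation at ONE instant (e.g. periodic in one direction) ⇒ `curl v ≡ 0`;
  `curl_eq_zero_of_curl_translate_on_open` — the same from invariance on one non-empty open set (identity theorem in the analytic frame).

HONEST LABEL: corollaries of landed theorems; nothing here proves `stub_scalarLiouville`, `PoloidalLiouville` (1222), or bears on Navier–Stokes regularity; no
summit statement is proved. [folklore] [cite: KochNadirashviliSereginSverak2009, Thm 5.2 (arXiv:0709.3599 pp. 9–10); LemarieRieusset2016, Thm. 9.12]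
-/

noncomputable section

-- the summit and its single sub-problem share the name (CONVENTIONS §1)
set_option linter.dupNamespace false

open scoped Topology InnerProductSpace RealInnerProductSpace ContDiff
open Filter Set Function Metric MeasureTheory
open Literature.Analysis Literature.Analysis.FluidPDE

namespace Summit.NavierStokesRegularity.NavierStokesRegularity.Theorems.PoloidalLiouville.Antidynamo

open Summit.NavierStokesRegularity.NavierStokesRegularity.Theorems.PoloidalLiouville
  (toroidalPotential exists_norm_curl_le constantOfIrrotational)
open Summit.NavierStokesRegularity.NavierStokesRegularity.Theorems.PoloidalLiouville.NetFlux (E3)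

namespace OneInstant

/-! ### ★★★ Symmetry under a general rigid motion at one instant -/

/-- ★★★ **VORTICITY SYMMETRIC UNDER A RIGID MOTION `y ↦ R y + b` AT ONE INSTANT ⇒ IRROTATIONAL, OR THE MOTION FIXES `x₀` AND THE VORTICITY IS `R`-SYMMETRIC
ABOUT `x₀` AT EVERY INSTANT.**  Let `v` be a bounded ancient mild solution (`ν = 1`, duality class) with measurable slices, jointly smooth on `(−∞,0) × ℝ³`,
with vorticity tangent to the spheres about `x₀`.  If for ONE `t₁ < 0`, `curl v(t₁)(R y + b) = det R • R (curl v(t₁)(y))` for all `y`, then EITHER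
`curl v ≡ 0` OR `R x₀ + b = x₀` and `curl v(t)(x₀ + R y) = det R • R (curl v(t)(x₀ + y))` for ALL `t < 0`, `y`.  [`R x₀ + b` is a second centre at `t₁`.]
[cite: KochNadirashviliSereginSverak2009, Thm 5.2 (arXiv:0709.3599 pp. 9–10); LemarieRieusset2016, Thm. 9.12] -/
theorem curl_eq_zero_or_curl_symmetric_of_curl_rigidMotion_slice
    (v : ℝ → EuclideanSpace ℝ (Fin 3) → EuclideanSpace ℝ (Fin 3)) (x₀ : EuclideanSpace ℝ (Fin 3))
    (hB : Literature.Analysis.FluidPDE.IsBoundedAncientMildSolution 1 v)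
    (hm : ∀ t < 0, AEStronglyMeasurable (v t) volume)
    (hsm : ContDiffOn ℝ (⊤ : ℕ∞) (Function.uncurry v) (Set.Iio 0 ×ˢ Set.univ))
    (hun : ∀ t < 0, ∀ x, ⟪x - x₀, curl (v t) x⟫ = 0)
    (R : EuclideanSpace ℝ (Fin 3) ≃ₗᵢ[ℝ] EuclideanSpace ℝ (Fin 3)) (b : EuclideanSpace ℝ (Fin 3)) {t₁ : ℝ} (ht₁ : t₁ < 0)
    (hsym₁ : ∀ y, curl (v t₁) (R y + b) =
      (R : EuclideanSpace ℝ (Fin 3) →L[ℝ] EuclideanSpace ℝ (Fin 3)).det • R (curl (v t₁) y)) :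
    (∀ t < 0, ∀ x, curl (v t) x = 0) ∨
      (R x₀ + b = x₀ ∧ ∀ t < 0, ∀ y, curl (v t) (x₀ + R y) =
        (R : EuclideanSpace ℝ (Fin 3) →L[ℝ] EuclideanSpace ℝ (Fin 3)).det • R (curl (v t) (x₀ + y))) := by
  -- `R x₀ + b` is a second centre of tangency at `t₁`
  have hc₂ : ∀ z, ⟪z - (R x₀ + b), curl (v t₁) z⟫ = 0 := fun z => by
    set y : EuclideanSpace ℝ (Fin 3) := R.symm (z - b) with hy
    have hz : z = R y + b := by rw [hy, LinearIsometryEquiv.apply_symm_apply, sub_add_cancel]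
    rw [hz, hsym₁, inner_smul_right]
    have e2 : R y + b - (R x₀ + b) = R (y - x₀) := by rw [map_sub]; abel
    rw [e2, LinearIsometryEquiv.inner_map_map, hun t₁ ht₁, mul_zero]
  by_cases hfix : R x₀ + b = x₀
  · -- the motion fixes `x₀`: it is `y ↦ x₀ + R (y − x₀)`
    have hsym' : ∀ y, curl (v t₁) (x₀ + R y) =
        (R : EuclideanSpace ℝ (Fin 3) →L[ℝ] EuclideanSpace ℝ (Fin 3)).det • R (curl (v t₁) (x₀ + y)) := fun y => by
      have h := hsym₁ (x₀ + y)
      have e1 : R (x₀ + y) + b = x₀ + R y := by rw [map_add, add_right_comm, hfix]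
      rwa [e1] at h
    rcases curl_eq_zero_or_curl_symmetric_of_curl_symmetric_slice v x₀ hB hm hsm hun R x₀ ht₁ hsym' with h | h
    · exact Or.inl h
    · exact Or.inr ⟨hfix, h⟩
  · -- the motion moves `x₀`: a second centre at one instant
    exact Or.inl (curl_eq_zero_of_two_centres_slice v x₀ hB hm hsm hun ⟨t₁, ht₁, R x₀ + b, hfix, hc₂⟩)

/-- ★★★ **… OR THE MOTION FIXES `x₀` AND THE VELOCITY IS EXACTLY `R`-EQUIVARIANT ABOUT `x₀` AT EVERY TIME.** [cite: KochNadirashviliSereginSverak2009, Thm 5.2 (arXiv:0709.3599 pp. 9–10)] -/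
theorem curl_eq_zero_or_equivariant_of_curl_rigidMotion_slice
    (v : ℝ → EuclideanSpace ℝ (Fin 3) → EuclideanSpace ℝ (Fin 3)) (x₀ : EuclideanSpace ℝ (Fin 3))
    (hB : Literature.Analysis.FluidPDE.IsBoundedAncientMildSolution 1 v)
    (hm : ∀ t < 0, AEStronglyMeasurable (v t) volume)
    (hsm : ContDiffOn ℝ (⊤ : ℕ∞) (Function.uncurry v) (Set.Iio 0 ×ˢ Set.univ))
    (hun : ∀ t < 0, ∀ x, ⟪x - x₀, curl (v t) x⟫ = 0)
    (R : EuclideanSpace ℝ (Fin 3) ≃ₗᵢ[ℝ] EuclideanSpace ℝ (Fin 3)) (b : EuclideanSpace ℝ (Fin 3)) {t₁ : ℝ} (ht₁ : t₁ < 0)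
    (hsym₁ : ∀ y, curl (v t₁) (R y + b) =
      (R : EuclideanSpace ℝ (Fin 3) →L[ℝ] EuclideanSpace ℝ (Fin 3)).det • R (curl (v t₁) y)) :
    (∀ t < 0, ∀ x, curl (v t) x = 0) ∨ (R x₀ + b = x₀ ∧ ∀ t < 0, ∀ y, v t (x₀ + R y) = R (v t (x₀ + y))) := by
  rcases curl_eq_zero_or_curl_symmetric_of_curl_rigidMotion_slice v x₀ hB hm hsm hun R b ht₁ hsym₁ with h | ⟨hfix, h⟩
  · exact Or.inl h
  · rcases curl_eq_zero_or_equivariant_of_curl_symmetric v x₀ hB hm hsm hun R h with h' | h'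
    · exact Or.inl h'
    · exact Or.inr ⟨hfix, h'⟩

/-! ### ★★ Translation invariance at one instant -/

/-- ★★ **VORTICITY INVARIANT UNDER ONE NON-ZERO TRANSLATION AT ONE INSTANT ⇒ IRROTATIONAL** (in particular: vorticity periodic in one direction, or
independent of one coordinate, at one instant).  `x₀ − d` is a second centre of tangency at that instant. [cite: KochNadirashviliSereginSverak2009, Thm 5.2 (arXiv:0709.3599 pp. 9–10)] -/
theorem curl_eq_zero_of_curl_translate_slice
    (v : ℝ → EuclideanSpace ℝ (Fin 3) → EuclideanSpace ℝ (Fin 3)) (x₀ : EuclideanSpace ℝ (Fin 3))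
    (hB : Literature.Analysis.FluidPDE.IsBoundedAncientMildSolution 1 v)
    (hm : ∀ t < 0, AEStronglyMeasurable (v t) volume)
    (hsm : ContDiffOn ℝ (⊤ : ℕ∞) (Function.uncurry v) (Set.Iio 0 ×ˢ Set.univ))
    (hun : ∀ t < 0, ∀ x, ⟪x - x₀, curl (v t) x⟫ = 0)
    (h₁ : ∃ t₁ < 0, ∃ d : EuclideanSpace ℝ (Fin 3), d ≠ 0 ∧ ∀ y, curl (v t₁) (y + d) = curl (v t₁) y) :
    ∀ t < 0, ∀ x, curl (v t) x = 0 := by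
  obtain ⟨t₁, ht₁, d, hd, hper⟩ := h₁
  refine curl_eq_zero_of_two_centres_slice v x₀ hB hm hsm hun ⟨t₁, ht₁, x₀ - d, ?_, fun z => ?_⟩
  · intro h
    exact hd (by simpa using h)
  · have h := hun t₁ ht₁ (z + d)
    rw [hper] at h
    have e1 : z + d - x₀ = z - (x₀ - d) := by abel
    rwa [e1] at h

/-- ★★ **… EVEN IF THE INVARIANCE HOLDS ONLY ON ONE NON-EMPTY OPEN SET** (identity theorem in the analytic frame). [cite: KochNadirashviliSereginSverak2009, Thm 5.2 (arXiv:0709.3599 pp. 9–10); LemarieRieusset2016, Thm. 9.12] -/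
theorem curl_eq_zero_of_curl_translate_on_open
    (v : ℝ → EuclideanSpace ℝ (Fin 3) → EuclideanSpace ℝ (Fin 3)) (x₀ : EuclideanSpace ℝ (Fin 3))
    (hB : Literature.Analysis.FluidPDE.IsBoundedAncientMildSolution 1 v)
    (hm : ∀ t < 0, AEStronglyMeasurable (v t) volume)
    (hsm : ContDiffOn ℝ (⊤ : ℕ∞) (Function.uncurry v) (Set.Iio 0 ×ˢ Set.univ))
    (hun : ∀ t < 0, ∀ x, ⟪x - x₀, curl (v t) x⟫ = 0)
    (hU : ∃ t₁ < 0, ∃ d : EuclideanSpace ℝ (Fin 3), d ≠ 0 ∧ ∃ U : Set (EuclideanSpace ℝ (Fin 3)), IsOpen U ∧ U.Nonempty ∧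
      ∀ y ∈ U, curl (v t₁) (y + d) = curl (v t₁) y) :
    ∀ t < 0, ∀ x, curl (v t) x = 0 := by
  obtain ⟨t₁, ht₁, d, hd, U, hUo, ⟨y₀, hy₀⟩, hUd⟩ := hU
  obtain ⟨K, hK⟩ := exists_norm_curl_le hB hsm
  obtain ⟨T, -, -, hlink⟩ := toroidalPotential v x₀ K hsm hK hun
  rcases CellFlux.unthreadedAnalyticOrIrrotational v x₀ T hB hm hsm hlink with hA | hZ
  · have hsl : ∀ z : E3, AnalyticAt ℝ (curl (v t₁)) z := fun z => analyticAt_curl_slice hA ht₁ z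
    set f : E3 → E3 := fun y => curl (v t₁) (y + d) - curl (v t₁) y with hf
    have hfa : AnalyticOnNhd ℝ f univ := by
      intro y _
      simp only [hf]
      fun_prop
    have hev : f =ᶠ[𝓝 y₀] 0 := by
      filter_upwards [hUo.mem_nhds hy₀] with z hz
      simp only [hf, Pi.zero_apply, sub_eq_zero]
      exact hUd z hz
    refine curl_eq_zero_of_curl_translate_slice v x₀ hB hm hsm hun ⟨t₁, ht₁, d, hd, fun y => ?_⟩
    have h0 := hfa.eqOn_zero_of_preconnected_of_eventuallyEq_zero isPreconnected_univ (mem_univ y₀) hev (mem_univ y)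
    simpa [hf, sub_eq_zero] using h0
  · exact hZ

/-- ★★ **… HENCE SLICE-WISE CONSTANT.** [cite: KochNadirashviliSereginSverak2009, Thm 5.2 (arXiv:0709.3599 pp. 9–10)] -/
theorem constant_of_curl_translate_on_open
    (v : ℝ → EuclideanSpace ℝ (Fin 3) → EuclideanSpace ℝ (Fin 3)) (x₀ : EuclideanSpace ℝ (Fin 3))
    (hB : Literature.Analysis.FluidPDE.IsBoundedAncientMildSolution 1 v)
    (hm : ∀ t < 0, AEStronglyMeasurable (v t) volume)
    (hsm : ContDiffOn ℝ (⊤ : ℕ∞) (Function.uncurry v) (Set.Iio 0 ×ˢ Set.univ))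
    (hun : ∀ t < 0, ∀ x, ⟪x - x₀, curl (v t) x⟫ = 0)
    (hU : ∃ t₁ < 0, ∃ d : EuclideanSpace ℝ (Fin 3), d ≠ 0 ∧ ∃ U : Set (EuclideanSpace ℝ (Fin 3)), IsOpen U ∧ U.Nonempty ∧
      ∀ y ∈ U, curl (v t₁) (y + d) = curl (v t₁) y) :
    ∀ t < 0, ∃ c : EuclideanSpace ℝ (Fin 3), ∀ x, v t x = c :=
  constantOfIrrotational v hB hsm (curl_eq_zero_of_curl_translate_on_open v x₀ hB hm hsm hun hU)

end OneInstant

end Summit.NavierStokesRegularity.NavierStokesRegularity.Theorems.PoloidalLiouville.Antidynamo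

end
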